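import Summits.Ventures.Crystal3D.Theorems.StickyWulffConstantTextureLiminfTexShadowResLastDefs
import HarnessLib

/-!
# TexShadow row (e), K3: the Barlow-aware ONE-SIDED COVERAGE CERTIFICATE predicate and the regime split of the faulted residual core
# (lane T, crux `TextureLiminfV5`, stmt-Ventures-23912; cf-p1 g31 «g11 QUEUE OF RECORD» (ii), 2026-08-29T03:40:39Z; spec HOME/wall-p2-g10/K3-ENGINE-SPEC.md)

HONEST FRAMING. Venture `Summits/Ventures/Crystal3D` (cell `crystal3d-full`), route `route-Ventures-StickyWulffConstant`, helper
`--supports` the law-v5 crux `TextureLiminfV5` (stmt-Ventures-23912), registered line `TexShadow` v8.2, stub `stub_residualFaultedCore :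
∃ C, BilayerWallResidualFaultedCoreAt (13/25) C 10`.  DEFINITIONS ONLY (+ two one-line unfoldings); nothing about any wall law is proved or
claimed; NO certificate is asserted; rung F-C1 not moved.

THE CUT (FAULTED-LEDGER-MEMO §3 K1a/K3/K4, cf-p1 (xciii)).  Lane G's one-sided Barlow ledger K1a is in the tree for the CANONICAL family of an
up-presented plate at steering `e₃` (`barlow_hlines_oriented_oneSided` p691515 / `…_top` p691813) together with wulff-p2's T-side cell glue
(`bilayerWallAt_of_lineCount_oneSided(_top)` p692930).  What K1a needs from a pair of presented plates `(L₁, σ₁ | L₂, σ₂)` is ORIENTATION DATA ONLY: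
* **`FluxFeasible c₀ L σ e`** — the plate is Δ-steep toward `e` and EVERY bilayer rises `≥ √2·c₀` (`bilayerRise`, both strip types; then
  `plateFlux/2 ≥ c₀` dominates every `c₀`-admissible table one-sidedly — test (γ) of the K3 spec);
* **`BarlowUpCertified c₀ σ₁ L₁ L₂`** — plate 1 is flux-feasible toward `e₃` AND clause (i) of `ZigFramesApart`: no forced chain frame of its
  canonical zig family (`zigFrames L₁ e₃`) carries plate 2's presented lattice or its basal twin (test (α)); **`BarlowDownCertified`** — the mirror
  statement for plate 2 toward `−e₃` (clause (ii)); **`BarlowOneSidedCertified`** — their disjunction (the K3 engine's per-box target, canonical slots).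
* **`ResidualOneSidedCoverageBarlowOn Reg c₀`** — THE CERTIFICATE SCHEMA: every FAULTED Hägg pair of presented plates in the orientation regime `Reg`
  is one-sidedly certified.  `Reg` is a PARAMETER: the engine (19480-p1 g14, K3-ENGINE-SPEC) reports the region it certifies; the candidate of
  record is `Reg := ¬ EdgeOnAt c₀` («some plate is flux-feasible»), typed as **`ResidualOneSidedCoverageBarlow c₀`** — a CANDIDATE named fact, not
  asserted here (if the engine leaves in-regime holes they join the remainder, cf-p1 (xciii)(4) Q-c ⇒ K1b).
* **`BilayerWallFaultedOnAt Reg c₀ C R₀`** — the WHOLE cell law at cap `c₀` for faulted pairs restricted to `Reg` (what K1a + a certificate on `Reg`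
  deliver: no residual-class, no leaf hypothesis is needed); **`BilayerWallResidualFaultedCoreOnAt Rem c₀ C R₀`** — the v8.2 core stub restricted to
  the orientation region `Rem` (the VISIBLE remainder); **`EdgeOnAt c₀`** — K4, the EDGE-ON regime (neither plate flux-feasible; FAULTED-LEDGER-MEMO
  §2: both active tilts beyond `51.3°` at `c₀ = 13/25`) and **`BilayerWallResidualFaultedEdgeOnAt c₀ C R₀`** := the core on `EdgeOnAt c₀` (cf-p1
  (xciii) Q-a: the open regime kept visible; director spec EO-0 «regime predicate in tree terms»).
The closer (`…TexShadowCoverageBarlowGlue`, next file): `BilayerWallFaultedOnAt Reg` from a certificate on `Reg`; core = on-`Reg` part + core-on-`Rem`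
part whenever `Reg ∨ Rem` exhausts the pairs; instance `Reg := ¬EdgeOnAt`, `Rem := EdgeOnAt`.
WHAT THIS IS NOT: no certificate is claimed (the K3 engine run is 19480-p1 g14's; PREREG amendment first); chosen-slot families (`…_oneSided_at v`,
p692347) and general steering (K1b) are NOT in this menu; F-C1 not moved.
-/

noncomputable section

open scoped BigOperators InnerProductSpace ENNReal
open MeasureTheory Filter

namespace Summit.Ventures.Crystal3D.Cruxes.TextureLiminf.TexShadow

open Summit.Ventures.Crystal3D Summit.Ventures.Crystal3D.Theorems
open Literature.MathematicalPhysics.StatisticalMechanics (IsHaggSeq fccStacking barlowStacking basalMirror)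

/-! ## The per-plate flux test and the per-pair family certificates (K3-ENGINE-SPEC §2–§3, canonical slots, steering `±e₃`) -/

/-- **Flux-feasible plate** (test (γ) + launch): the presented plate `(L, σ)` is Δ-steep toward `e` and EVERY bilayer's zigzag rise toward `e`
is `≥ √2·c₀` (Δ-bilayers: the best reference up-slot; ∇-bilayers: the best capper — `bilayerRise`), so that the canonical one-sided walker family
delivers flux `√2·bilayerRise ≥ 2c₀` per strip, i.e. dominates every `c₀`-admissible table strip by strip.  Presentation-covariant
(`bilayerRise_reverse`). -/
def FluxFeasible (c₀ : ℝ) (L : E3 ≃ₗᵢ[ℝ] E3) (σ : ℤ → ℤ) (e : E3) : Prop :=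
  DeltaSteep L e ∧ ∀ i : ℤ, Real.sqrt 2 * c₀ ≤ bilayerRise L σ e i

/-- **UP family certified at charge `c₀`** (plate 1 active, steering `e₃`, canonical slot): plate 1 is flux-feasible toward `e₃` and NO forced
chain frame of its canonical zig family (`zigFrames L₁ e₃` = `chainFrames e₃ (upFrame L₁ e₃) (famSlot L₁ e₃)`) carries plate 2's presented
lattice `L₂·Λ₀` or its basal twin `twinFrame L₂ (L₂e₃)·Λ₀` — clause (i) of `ZigFramesApart`, exactly `hapart₁` of `barlow_hlines_oriented_oneSided`. -/
def BarlowUpCertified (c₀ : ℝ) (σ₁ : ℤ → ℤ) (L₁ L₂ : E3 ≃ₗᵢ[ℝ] E3) : Prop :=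
  FluxFeasible c₀ L₁ σ₁ e₃ ∧
    ∀ F ∈ zigFrames L₁ e₃,
      F '' fccStacking 1 (Real.sqrt (2 / 3)) ≠ L₂ '' fccStacking 1 (Real.sqrt (2 / 3)) ∧
      F '' fccStacking 1 (Real.sqrt (2 / 3)) ≠ (twinFrame L₂ (L₂ e₃)) '' fccStacking 1 (Real.sqrt (2 / 3))

/-- **DOWN family certified at charge `c₀`** (plate 2 active, steering `−e₃`, canonical slot): plate 2 is flux-feasible toward `−e₃` and no forced
chain frame of `zigFrames L₂ (−e₃)` carries plate 1's presented lattice or its basal twin — clause (ii) of `ZigFramesApart`, `hapart₂` of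
`barlow_hlines_oriented_oneSided_top`. -/
def BarlowDownCertified (c₀ : ℝ) (σ₂ : ℤ → ℤ) (L₁ L₂ : E3 ≃ₗᵢ[ℝ] E3) : Prop :=
  FluxFeasible c₀ L₂ σ₂ (-e₃) ∧
    ∀ F ∈ zigFrames L₂ (-e₃),
      F '' fccStacking 1 (Real.sqrt (2 / 3)) ≠ L₁ '' fccStacking 1 (Real.sqrt (2 / 3)) ∧
      F '' fccStacking 1 (Real.sqrt (2 / 3)) ≠ (twinFrame L₁ (L₁ e₃)) '' fccStacking 1 (Real.sqrt (2 / 3))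

/-- **One-sidedly certified pair at charge `c₀`**: the UP family of plate 1 or the DOWN family of plate 2 is certified (the K3 engine's per-box
verdict «COVERED», canonical-slot menu). -/
def BarlowOneSidedCertified (c₀ : ℝ) (σ₁ σ₂ : ℤ → ℤ) (L₁ L₂ : E3 ≃ₗᵢ[ℝ] E3) : Prop :=
  BarlowUpCertified c₀ σ₁ L₁ L₂ ∨ BarlowDownCertified c₀ σ₂ L₁ L₂

/-! ## The K4 regime -/

/-- **EDGE-ON regime at charge `c₀` (K4)**: NEITHER plate is flux-feasible toward the wall (plate 1 toward `e₃`, plate 2 toward `−e₃`).  At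
`c₀ = 13/25` this is «both active tilts beyond ≈ 51.3°» up to azimuth (FAULTED-LEDGER-MEMO §2: worst-azimuth rise `√(2/3)cos θ + sin θ/(2√3)`);
no `e₃`-steered one-sided walker family prices these pairs (cf-p1 (xciii) Q-a: open regime, kept visible). -/
def EdgeOnAt (c₀ : ℝ) (σ₁ σ₂ : ℤ → ℤ) (L₁ L₂ : E3 ≃ₗᵢ[ℝ] E3) : Prop :=
  ¬ FluxFeasible c₀ L₁ σ₁ e₃ ∧ ¬ FluxFeasible c₀ L₂ σ₂ (-e₃)

/-! ## The certificate schema and its candidate instance -/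

/-- **THE ONE-SIDED BARLOW COVERAGE CERTIFICATE ON THE REGIME `Reg`** (schema of the K3 named computational fact): every FAULTED pair of Hägg words
and every pair of presented plate frames in the orientation regime `Reg` is one-sidedly certified at charge `c₀` (canonical slots, steering
`±e₃`).  The engine's deliverable is a region `Reg` (per reduced mirror word `κ`: boxes in the wall normal of plate 1's model, finite part + the
unread tail of `…TailSeparationOneSided`) together with this statement for it. -/
def ResidualOneSidedCoverageBarlowOn (Reg : (ℤ → ℤ) → (ℤ → ℤ) → (E3 ≃ₗᵢ[ℝ] E3) → (E3 ≃ₗᵢ[ℝ] E3) → Prop) (c₀ : ℝ) : Prop :=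
  ∀ (σ₁ σ₂ : ℤ → ℤ), IsHaggSeq σ₁ → IsHaggSeq σ₂ → ¬ BothFcc σ₁ σ₂ →
    ∀ (L₁ L₂ : E3 ≃ₗᵢ[ℝ] E3), Reg σ₁ σ₂ L₁ L₂ → BarlowOneSidedCertified c₀ σ₁ σ₂ L₁ L₂

/-- **`ResidualOneSidedCoverageBarlow c₀` — the CANDIDATE named fact of row (e)** (NOT asserted; to be certified or cut down by the K3 engine):
outside the edge-on regime — i.e. whenever SOME plate is flux-feasible — some plate's canonical family is moreover frames-apart from the other
plate's two presented lattices.  Known risk (K3-ENGINE-SPEC §5, cf-p1 (xciii)(4) Q-c): in-regime boxes where the flux-feasible plate's canonical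
ray READS the passive plate (then chosen slots `…_oneSided_at v` / general steering K1b, or the box joins the remainder). -/
def ResidualOneSidedCoverageBarlow (c₀ : ℝ) : Prop :=
  ResidualOneSidedCoverageBarlowOn (fun σ₁ σ₂ L₁ L₂ => ¬ EdgeOnAt c₀ σ₁ σ₂ L₁ L₂) c₀

/-! ## The regime-restricted wall statements -/

/-- **The whole cell law at cap `c₀`, constants `(C, R₀)`, for FAULTED pairs in the regime `Reg`** — what lane G's K1a delivers from a certificate on
`Reg` (next file): NO residual-class hypothesis, NO leaf hypothesis, every `c₀`-admissible table. -/
def BilayerWallFaultedOnAt (Reg : (ℤ → ℤ) → (ℤ → ℤ) → (E3 ≃ₗᵢ[ℝ] E3) → (E3 ≃ₗᵢ[ℝ] E3) → Prop) (c₀ C R₀ : ℝ) : Prop :=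
  ∀ (σ₁ σ₂ : ℤ → ℤ), IsHaggSeq σ₁ → IsHaggSeq σ₂ → ¬ BothFcc σ₁ σ₂ →
    ∀ (L₁ L₂ : E3 ≃ₗᵢ[ℝ] E3) (s₁ s₂ : E3) (A₁ A₂ : ℤ → (E3 ≃ₗᵢ[ℝ] E3)) (u₁ u₂ : ℤ → E3),
    BilayerFramesAt L₁ s₁ σ₁ A₁ u₁ → BilayerFramesAt L₂ s₂ σ₂ A₂ u₂ → Reg σ₁ σ₂ L₁ L₂ →
    ∀ (c : ℤ → ℤ → ℝ) (m : ℤ → ℤ → E3), BilayerChargeAdmissibleAt c₀ A₁ A₂ c m →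
      BilayerWallAt C R₀ σ₁ σ₂ L₁ L₂ s₁ s₂ c

/-- **The faulted residual CORE (v8.2, `BilayerWallResidualFaultedCoreAt`) RESTRICTED to the orientation region `Rem`** — verbatim the core's
hypotheses (faulted, bilayer frames, `RES`, `c₀`-admissible table, the three owed leaves) plus `Rem σ₁ σ₂ L₁ L₂`; the shape of the visible
remainder once a certificate prices the complement of `Rem`. -/
def BilayerWallResidualFaultedCoreOnAt (Rem : (ℤ → ℤ) → (ℤ → ℤ) → (E3 ≃ₗᵢ[ℝ] E3) → (E3 ≃ₗᵢ[ℝ] E3) → Prop) (c₀ C R₀ : ℝ) : Prop :=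
  ∀ (σ₁ σ₂ : ℤ → ℤ), IsHaggSeq σ₁ → IsHaggSeq σ₂ → ¬ BothFcc σ₁ σ₂ →
    ∀ (L₁ L₂ : E3 ≃ₗᵢ[ℝ] E3) (s₁ s₂ : E3) (A₁ A₂ : ℤ → (E3 ≃ₗᵢ[ℝ] E3)) (u₁ u₂ : ℤ → E3),
    BilayerFramesAt L₁ s₁ σ₁ A₁ u₁ → BilayerFramesAt L₂ s₂ σ₂ A₂ u₂ →
    (∃ i j : ℤ, InResidualClass (A₁ i) (A₂ j) (u₁ i) (u₂ j)) → Rem σ₁ σ₂ L₁ L₂ →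
    ∀ (c : ℤ → ℤ → ℝ) (m : ℤ → ℤ → E3), BilayerChargeAdmissibleAt c₀ A₁ A₂ c m →
      ((DomBy L₁ σ₁ L₂ σ₂ c ∧
          ∃ F₁ ∈ cornerFrames L₁ σ₁ e₃, ∃ F₂ ∈ cornerFrames L₂ σ₂ (-e₃), CoAxFrames F₁ F₂) ∨
        (DeltaSteep L₁ e₃ ∧ DeltaSteep L₂ (-e₃) ∧ FluxDominated (Real.sqrt 2 / 2) L₁ σ₁ L₂ σ₂ c ∧
          ¬ BarlowOffReach L₁ s₁ σ₁ L₂ s₂ σ₂ ∧ ¬ RowMixDominated (Real.sqrt 2 / 2) L₁ σ₁ L₂ σ₂ c ∧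
          ¬ (ZigGood L₁ σ₁ e₃ ∧ ZigGood L₂ σ₂ (-e₃)) ∧
          ∃ F₁ ∈ zigFrames L₁ e₃, ∃ F₂ ∈ zigFrames L₂ (-e₃), CoAxFrames F₁ F₂) ∨
        (¬ (DeltaSteep L₁ e₃ ∧ DeltaSteep L₂ (-e₃) ∧ FluxDominated (Real.sqrt 2 / 2) L₁ σ₁ L₂ σ₂ c) ∧
          ¬ RowMixDominated (Real.sqrt 2 / 2) L₁ σ₁ L₂ σ₂ c ∧
          ¬ RowMixDominated (Real.sqrt 2 / 2) (basalMirror.trans L₁) (fun n => -σ₁ (-n - 1)) L₂ σ₂ (fun i j => c (-i - 1) j) ∧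
          ¬ RowMixDominated (Real.sqrt 2 / 2) L₁ σ₁ (basalMirror.trans L₂) (fun n => -σ₂ (-n - 1)) (fun i j => c i (-j - 1)) ∧
          ¬ RowMixDominated (Real.sqrt 2 / 2) (basalMirror.trans L₁) (fun n => -σ₁ (-n - 1))
              (basalMirror.trans L₂) (fun n => -σ₂ (-n - 1)) (fun i j => c (-i - 1) (-j - 1)))) →
      BilayerWallAt C R₀ σ₁ σ₂ L₁ L₂ s₁ s₂ c

/-- **K4 — the faulted residual core in the EDGE-ON regime** (`BilayerWallResidualFaultedCoreOnAt (EdgeOnAt c₀)`): the open sub-stub of row (e)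
kept visible (cf-p1 (xciii) Q-a; director spec EO-0…EO-4, ROUTE.md §86(240)). -/
def BilayerWallResidualFaultedEdgeOnAt (c₀ C R₀ : ℝ) : Prop :=
  BilayerWallResidualFaultedCoreOnAt (EdgeOnAt c₀) c₀ C R₀

/-! ## One-line unfoldings -/

/-- The core is its restriction to the trivial region. -/
theorem residualFaultedCoreOnAt_true_iff {c₀ C R₀ : ℝ} :
    BilayerWallResidualFaultedCoreOnAt (fun _ _ _ _ => True) c₀ C R₀ ↔ BilayerWallResidualFaultedCoreAt c₀ C R₀ :=
  ⟨fun h σ₁ σ₂ hσ₁ hσ₂ hf L₁ L₂ s₁ s₂ A₁ A₂ u₁ u₂ hA₁ hA₂ hres c m hadm hleaf =>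
      h σ₁ σ₂ hσ₁ hσ₂ hf L₁ L₂ s₁ s₂ A₁ A₂ u₁ u₂ hA₁ hA₂ hres trivial c m hadm hleaf,
    fun h σ₁ σ₂ hσ₁ hσ₂ hf L₁ L₂ s₁ s₂ A₁ A₂ u₁ u₂ hA₁ hA₂ hres _ c m hadm hleaf =>
      h σ₁ σ₂ hσ₁ hσ₂ hf L₁ L₂ s₁ s₂ A₁ A₂ u₁ u₂ hA₁ hA₂ hres c m hadm hleaf⟩

/-- The core restricts to every region (the remainder stubs are WEAKER than the registered core stub). -/
theorem residualFaultedCoreOnAt_of_coreAt {Rem : (ℤ → ℤ) → (ℤ → ℤ) → (E3 ≃ₗᵢ[ℝ] E3) → (E3 ≃ₗᵢ[ℝ] E3) → Prop} {c₀ C R₀ : ℝ}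
    (h : BilayerWallResidualFaultedCoreAt c₀ C R₀) : BilayerWallResidualFaultedCoreOnAt Rem c₀ C R₀ :=
  fun σ₁ σ₂ hσ₁ hσ₂ hf L₁ L₂ s₁ s₂ A₁ A₂ u₁ u₂ hA₁ hA₂ hres _ c m hadm hleaf =>
    h σ₁ σ₂ hσ₁ hσ₂ hf L₁ L₂ s₁ s₂ A₁ A₂ u₁ u₂ hA₁ hA₂ hres c m hadm hleaf

/-- The on-`Reg` law restricts the core: pairs in `Reg` need no leaf hypothesis. -/
theorem residualFaultedCoreOnAt_of_faultedOnAt {Reg : (ℤ → ℤ) → (ℤ → ℤ) → (E3 ≃ₗᵢ[ℝ] E3) → (E3 ≃ₗᵢ[ℝ] E3) → Prop} {c₀ C R₀ : ℝ}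
    (h : BilayerWallFaultedOnAt Reg c₀ C R₀) : BilayerWallResidualFaultedCoreOnAt Reg c₀ C R₀ :=
  fun σ₁ σ₂ hσ₁ hσ₂ hf L₁ L₂ s₁ s₂ A₁ A₂ u₁ u₂ hA₁ hA₂ _ hreg c m hadm _ =>
    h σ₁ σ₂ hσ₁ hσ₂ hf L₁ L₂ s₁ s₂ A₁ A₂ u₁ u₂ hA₁ hA₂ hreg c m hadm

/-- Certificates restrict along implications of regimes. -/
theorem residualOneSidedCoverageBarlowOn_mono
    {Reg Reg' : (ℤ → ℤ) → (ℤ → ℤ) → (E3 ≃ₗᵢ[ℝ] E3) → (E3 ≃ₗᵢ[ℝ] E3) → Prop}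
    (hle : ∀ σ₁ σ₂ L₁ L₂, Reg' σ₁ σ₂ L₁ L₂ → Reg σ₁ σ₂ L₁ L₂) {c₀ : ℝ} (h : ResidualOneSidedCoverageBarlowOn Reg c₀) :
    ResidualOneSidedCoverageBarlowOn Reg' c₀ :=
  fun σ₁ σ₂ hσ₁ hσ₂ hf L₁ L₂ hreg => h σ₁ σ₂ hσ₁ hσ₂ hf L₁ L₂ (hle σ₁ σ₂ L₁ L₂ hreg)

end Summit.Ventures.Crystal3D.Cruxes.TextureLiminf.TexShadow

end
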